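import Summits.CriticalPhenomena.PercolationContinuityZ3.Theorems.PercNearOneGluingNoHeavyQuantBlobDecTwoCerts
import HarnessLib

/-!
# QUANT lane R8, T-DEC finite-layer half: BLOB-DEC(2), part II — the GREEDY-DEC inequalities for TWO heavy blobs, every floor

builds on p205010 (kernel theorem, internal audit signed; external expert review pending)

Support file (`--supports stmt-CriticalPhenomena-4575`), QUANT lane seat prim-quant-census-2 (gen 51); memos
`run/shared/lean/prim/quant/prim-quant-census-2-g50/DEC-TAMP-G50.md` §3.6–3.8 and
`run/shared/lean/prim/quant/prim-quant-census-2-g51/BLOB-DEC2-G51.md`.  Pure real algebra (no probability); theorems only,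
no sorries, standard axioms.  Companion of `…QuantTwoPointMeanMixture` / `…QuantTwoPointTopAffordable` (T-DEC at layers above
the top atom, prim-quant-census-2 g50); the polynomial certificates are part I (`…QuantBlobDecTwoCerts`).

SETTING (ARCH-TREES-G49 §2.2 / DEC-TAMP-G50 §3.1, §3.7).  Two independent heavy blobs `(a, g₁ = u)` and `(b, g₂ = v)`, sizes
`0 < a < b`, floor `0 < y ≤ min(u, v)`, mean `T = a u + b v`; the law has atoms `0, a, b, a+b` with masses
`(1−u)(1−v), u(1−v), (1−u)v, uv`.  At an effective layer `j'` with `T/2 ≤ j' < a + b` the DEC(j') linear programme asks to pair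
every LOW atom (`2k < T`, `k ≤ j'`) with self-sufficient partners: the GIANT `a+b` at gate exactly `y` (one unit of low mass uses
`y/(1−y)` units of giant mass) or a MID atom `m ≤ j'`, `2m ≥ T` at its minimal credit gate
`γ = max(ρ, y² + (1−y)ρ)`, `ρ = (T − 2·lo)/(m − lo)` (credit `2lo + (m − lo)κ_y(γ) = T`; one unit of low mass uses `γ/(1−γ)` units of
mid mass).  GREEDY-DEC (DEC-TAMP-G50 §3.7): lows ride with the giant first, the residual low mass goes through the cheapest
(low, mid) pairs.  For two blobs, feasibility of the LP = success of GREEDY = ONE inequality per class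
(BLOB-DEC2-G51 §1; the layer `j'` enters only through the class):

* class G (`b ≥ j'+1`): `y(1−v) ≤ (1−y)v` — `classG`;
* class AB (`T ≤ 2a`, `b ≤ j'`; only atom `0` is low; mids `a`, `b` through the heavy pairs `(0,a)`, `(0,b)` at gates `T/a`, `T/b`):
  `(1−u)(1−v) − uv(1−y)/y ≤ ([u(1−v)(a−T)]⁺ + [(1−u)v(b−T)]⁺)/T` — `classAB` (`⟺ y(a+b) ≤ T` without the clipping; tight on
  tied blobs);
* class aB (`2a < T`, `b ≤ j' < a+b`; lows `0`, `a`; mid `b`; pair `(a,b)` at `γ`, pair `(0,b)` at `T/b`): the minimal mid usage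
  `γ/(1−γ)·min(r, u(1−v)) + T/(b−T)·(r − u(1−v))⁺ ≤ (1−u)v`, `r = (1−v) − uv(1−y)/y` — `classaB`.

Proof of `classaB`: sub-case `r ≤ u(1−v)` is `subcase_one` (`γ ≤ v`, two lines); sub-case `r > u(1−v)` forces `u, v < 1/2` and is
`phi_nonneg`: the margin `Φ(y)` is non-increasing in the floor (`phi_mono`: the gate `max(ρ, y² + (1−y)ρ)` and the cost
`γ/(1−γ)` increase with `y`, the giant capacity `(1−y)/y` decreases), so the floor may be raised to `min(u, v)`; there
`phi_nonneg_small` (floor on the small blob, light/heavy regimes via `…Certs.NL_nonneg` / `NH_nonneg` — the sub-case left open in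
DEC-TAMP-G50 §3.8 (v)) and `phi_nonneg_big` (floor on the big blob, `…Certs.M_nonneg`, DEC-TAMP-G50 §3.8 (iv)) conclude.
Exact census (own LP ⟺ GREEDY ⟺ the class inequality with its proof margin, every floor on the grid, every non-dominant layer):
0 disagreements / 0 failures on 34 504 instances (den 12, sizes ≤ 5; cross-checked against the g49 `dec_cap` LP and the g50
`blob2.rule`) and on kit j125979 (den 24 sizes ≤ 8, den 36 sizes ≤ 5, 10⁶ random; BLOB-DEC2-G51 §3).  The tied family
`u = v = y < 1/2`, `a = 1`, `b → ∞` is asymptotically sharp (DEC-TAMP-G50 §3.8 (iii)).  What this does NOT do: k ≥ 3 blobs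
(GREEDY-DEC, 0 / ≈ 97 M instances, DEC-TAMP-G50 §3.7) and the propagation through gating remain conjectural.  [this work]
-/

namespace Summit.CriticalPhenomena.PercolationContinuityZ3.Theorems

namespace Quant

namespace BlobDec2

/-! ### 5. The GREEDY margin `Φ` of class aB, sub-case 2, at the tied floors -/

/-- Floor on the SMALL blob, LIGHT gate form `γ = u² + (1−u)ρ` (the minimal credit gate when `ρ ≤ u`; the inequality holds for
every `ρ`): the GREEDY margin `Φ = (1−u)v − u(1−v)·γ/(1−γ) − (1−u)(1−2v)·T/(b−T)` is nonnegative (DEC-TAMP-G50 §3.8 (v), light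
part). [this work] -/
theorem phi_nonneg_small_light (u v a b T ρ γ : ℝ) (hu : 0 < u) (huv : u ≤ v) (hv : v < 1 / 2) (ha : 0 < a) (hab : a < b)
    (hT : T = a * u + b * v) (hlow : 2 * a ≤ T) (hρ : ρ = (T - 2 * a) / (b - a))
    (hγ : γ = u ^ 2 + (1 - u) * ρ) :
    0 ≤ (1 - u) * v - u * (1 - v) * (γ / (1 - γ)) - (1 - u) * (1 - 2 * v) * (T / (b - T)) := by
  have hba : 0 < b - a := by linarith
  have hba' : b - a ≠ 0 := ne_of_gt hba
  have hu1 : 0 < 1 - u := by linarith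
  have hTb : T < b := by
    rw [hT]; nlinarith [mul_pos ha (by linarith : (0 : ℝ) < 1 / 2 - u), mul_pos (ha.trans hab) (by linarith : (0 : ℝ) < 1 / 2 - v)]
  have hbT : 0 < b - T := by linarith
  have hbT' : b - T ≠ 0 := ne_of_gt hbT
  have hKpos : 0 < b * (1 + u - v) + a * (1 - 2 * u) := by
    have h1 : 0 < b * (1 + u - v) := mul_pos (by linarith) (by linarith)
    have h2 : 0 < a * (1 - 2 * u) := mul_pos ha (by linarith)
    linarith
  have hu1' : 1 - u ≠ 0 := ne_of_gt hu1
  have hK' : b * (1 + u - v) + a * (1 - 2 * u) ≠ 0 := ne_of_gt hKpos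
  -- closed forms of `γ` and `1 - γ`
  have hγ' : γ = (u ^ 2 * (b - a) + (1 - u) * (T - 2 * a)) / (b - a) := by
    rw [hγ, hρ]; field_simp
  have h1γ : 1 - γ = (1 - u) * (b * (1 + u - v) + a * (1 - 2 * u)) / (b - a) := by
    rw [hγ', eq_div_iff hba']; field_simp; rw [hT]; ring
  have hfrac : γ / (1 - γ) = (u ^ 2 * (b - a) + (1 - u) * (T - 2 * a)) / ((1 - u) * (b * (1 + u - v) + a * (1 - 2 * u))) := by
    rw [h1γ, hγ', div_div_div_cancel_right₀ hba']
  rw [hfrac]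
  have hNN := NL_nonneg u v a b hu.le huv hv.le (by linarith) ha.le (by rw [hT] at hlow; linarith)
  have hclear : 0 < (1 - u) * (b * (1 + u - v) + a * (1 - 2 * u)) * (b - T) := by positivity
  have hid : ((1 - u) * v - u * (1 - v) * ((u ^ 2 * (b - a) + (1 - u) * (T - 2 * a))
          / ((1 - u) * (b * (1 + u - v) + a * (1 - 2 * u)))) - (1 - u) * (1 - 2 * v) * (T / (b - T)))
        * ((1 - u) * (b * (1 + u - v) + a * (1 - 2 * u)) * (b - T))
      = (1 - u) * v * (1 - u) * (b * (1 + u - v) + a * (1 - 2 * u)) * (b - (a * u + b * v))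
        - u * (1 - v) * (u ^ 2 * (b - a) + (1 - u) * ((a * u + b * v) - 2 * a)) * (b - (a * u + b * v))
        - (1 - u) * (1 - 2 * v) * (a * u + b * v) * (1 - u) * (b * (1 + u - v) + a * (1 - 2 * u)) := by
    set K := b * (1 + u - v) + a * (1 - 2 * u) with hK
    set S := b - T with hS
    have hTS : T = b - S := by rw [hS]; ring
    rw [hTS]
    field_simp
    rw [hK, hS, hT]
    ring
  exact le_of_mul_le_mul_right (by rw [zero_mul, hid]; exact hNN) hclear

/-- Floor on the SMALL blob, HEAVY pair (`y = u ≤ v < 1/2`, `ρ ≥ u`, `γ = ρ`): the GREEDY margin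
`Φ = (1−u)v − u(1−v)·γ/(1−γ) − (1−u)(1−2v)·T/(b−T)` is nonnegative (DEC-TAMP-G50 §3.8 (v), heavy part). [this work] -/
theorem phi_nonneg_small_heavy (u v a b T ρ γ : ℝ) (hu : 0 < u) (huv : u ≤ v) (hv : v < 1 / 2) (ha : 0 < a) (hab : a < b)
    (hT : T = a * u + b * v) (hρ : ρ = (T - 2 * a) / (b - a)) (hρu : u ≤ ρ) (hγ : γ = ρ) :
    0 ≤ (1 - u) * v - u * (1 - v) * (γ / (1 - γ)) - (1 - u) * (1 - 2 * v) * (T / (b - T)) := by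
  have hba : 0 < b - a := by linarith
  have hba' : b - a ≠ 0 := ne_of_gt hba
  have hTb : T < b := by
    rw [hT]; nlinarith [mul_pos ha (by linarith : (0 : ℝ) < 1 / 2 - u), mul_pos (ha.trans hab) (by linarith : (0 : ℝ) < 1 / 2 - v)]
  have hbT : 0 < b - T := by linarith
  have hbT' : b - T ≠ 0 := ne_of_gt hbT
  have habT : 0 < a + b - T := by linarith
  have habT' : a + b - T ≠ 0 := ne_of_gt habT
  have hD : 0 ≤ (v - u) * b - 2 * (1 - u) * a := by
    rw [hρ, le_div_iff₀ hba, hT] at hρu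
    linarith
  have h1γ : 1 - γ = (a + b - T) / (b - a) := by
    rw [hγ, hρ, eq_div_iff hba']; field_simp; ring
  have hfrac : γ / (1 - γ) = (T - 2 * a) / (a + b - T) := by
    rw [h1γ, hγ, hρ, div_div_div_cancel_right₀ hba']
  rw [hfrac]
  have hNN := NH_nonneg u v a b hu.le huv hv.le (by linarith) ha hD
  have hclear : 0 < (a + b - T) * (b - T) := by positivity
  have hid : ((1 - u) * v - u * (1 - v) * ((T - 2 * a) / (a + b - T)) - (1 - u) * (1 - 2 * v) * (T / (b - T)))
        * ((a + b - T) * (b - T))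
      = (1 - u) * v * (a + b - (a * u + b * v)) * (b - (a * u + b * v))
        - u * (1 - v) * ((a * u + b * v) - 2 * a) * (b - (a * u + b * v))
        - (1 - u) * (1 - 2 * v) * (a * u + b * v) * (a + b - (a * u + b * v)) := by
    set S := b - T with hS
    set R := a + b - T with hR
    have hTS : T = b - S := by rw [hS]; ring
    have hRS : R = a + S := by rw [hR, hS]; ring
    have haS : a + S ≠ 0 := by rw [← hRS]; exact habT'
    rw [hRS, hTS]
    field_simp
    rw [hS, hT]
    ring
  exact le_of_mul_le_mul_right (by rw [zero_mul, hid]; exact hNN) hclear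

/-- Floor on the SMALL blob (`y = u ≤ v < 1/2`), either regime: with `γ = max(ρ, u² + (1−u)ρ)` the GREEDY margin
`Φ(u) = (1−u)v − u(1−v)·γ/(1−γ) − (1−u)(1−2v)·T/(b−T) ≥ 0` — the sub-case of DEC-TAMP-G50 §3.8 (v), now closed. [this work] -/
theorem phi_nonneg_small (u v a b T ρ γ : ℝ) (hu : 0 < u) (huv : u ≤ v) (hv : v < 1 / 2) (ha : 0 < a) (hab : a < b)
    (hT : T = a * u + b * v) (hlow : 2 * a ≤ T) (hρ : ρ = (T - 2 * a) / (b - a))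
    (hγ : γ = max ρ (u ^ 2 + (1 - u) * ρ)) :
    0 ≤ (1 - u) * v - u * (1 - v) * (γ / (1 - γ)) - (1 - u) * (1 - 2 * v) * (T / (b - T)) := by
  rcases le_total ρ u with h | h
  · rw [gate_eq_light u ρ hu.le h] at hγ
    exact phi_nonneg_small_light u v a b T ρ γ hu huv hv ha hab hT hlow hρ hγ
  · rw [gate_eq_heavy u ρ hu.le h] at hγ
    exact phi_nonneg_small_heavy u v a b T ρ γ hu huv hv ha hab hT hρ h hγ

/-- Floor on the BIG blob (`y = v ≤ u < 1/2`): the pair `(a,b)` is always light (`ρ ≤ v`), and with `γ = max(ρ, v² + (1−v)ρ)`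
the GREEDY margin `Φ(v) = (1−u)v − u(1−v)·γ/(1−γ) − (1−v)(1−2u)·T/(b−T) ≥ 0` (DEC-TAMP-G50 §3.8 (iv): cleared margin
`(1−v)·a·u·M`). [this work] -/
theorem phi_nonneg_big (u v a b T ρ γ : ℝ) (hv : 0 < v) (hvu : v ≤ u) (hu : u < 1 / 2) (ha : 0 < a) (hab : a < b)
    (hT : T = a * u + b * v) (hlow : 2 * a ≤ T) (hρ : ρ = (T - 2 * a) / (b - a))
    (hγ : γ = max ρ (v ^ 2 + (1 - v) * ρ)) :
    0 ≤ (1 - u) * v - u * (1 - v) * (γ / (1 - γ)) - (1 - v) * (1 - 2 * u) * (T / (b - T)) := by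
  have hba : 0 < b - a := by linarith
  have hba' : b - a ≠ 0 := ne_of_gt hba
  have hv1 : 0 < 1 - v := by linarith
  have hTb : T < b := by
    rw [hT]; nlinarith [mul_pos ha (by linarith : (0 : ℝ) < 1 / 2 - u), mul_pos (ha.trans hab) (by linarith : (0 : ℝ) < 1 / 2 - v)]
  have hbT : 0 < b - T := by linarith
  have hbT' : b - T ≠ 0 := ne_of_gt hbT
  have hρv : ρ ≤ v := by
    rw [hρ, div_le_iff₀ hba, hT]; nlinarith [mul_nonneg ha.le (by linarith : (0 : ℝ) ≤ 2 - u - v)]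
  rw [gate_eq_light v ρ hv.le hρv] at hγ
  have hKpos : 0 < (a + b) - a * (u + v) := by nlinarith [mul_nonneg ha.le (by linarith : (0 : ℝ) ≤ 1 - u - v)]
  have hv1' : 1 - v ≠ 0 := ne_of_gt hv1
  have hK' : (a + b) - a * (u + v) ≠ 0 := ne_of_gt hKpos
  have hγ' : γ = (v ^ 2 * (b - a) + (1 - v) * (T - 2 * a)) / (b - a) := by
    rw [hγ, hρ]; field_simp
  have h1γ : 1 - γ = (1 - v) * ((a + b) - a * (u + v)) / (b - a) := by
    rw [hγ', eq_div_iff hba']; field_simp; rw [hT]; ring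
  have hfrac : γ / (1 - γ) = (v ^ 2 * (b - a) + (1 - v) * (T - 2 * a)) / ((1 - v) * ((a + b) - a * (u + v))) := by
    rw [h1γ, hγ', div_div_div_cancel_right₀ hba']
  rw [hfrac]
  have hM := M_nonneg u v a b hv hvu hu.le ha.le (by rw [hT] at hlow; linarith)
  have hNN : 0 ≤ (1 - v) * a * u * (b * (1 + u - 3 * v + u * v + v ^ 2) - a * (1 - u - v + u ^ 2 + u * v)) := by
    have : 0 ≤ (1 - v) * a * u := by
      have := hv.le.trans hvu
      positivity
    exact mul_nonneg this hM
  have hclear : 0 < (1 - v) * ((a + b) - a * (u + v)) * (b - T) := by positivity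
  have hid : ((1 - u) * v - u * (1 - v) * ((v ^ 2 * (b - a) + (1 - v) * (T - 2 * a)) / ((1 - v) * ((a + b) - a * (u + v))))
          - (1 - v) * (1 - 2 * u) * (T / (b - T))) * ((1 - v) * ((a + b) - a * (u + v)) * (b - T))
      = (1 - v) * a * u * (b * (1 + u - 3 * v + u * v + v ^ 2) - a * (1 - u - v + u ^ 2 + u * v)) := by
    set K := (a + b) - a * (u + v) with hK
    set S := b - T with hS
    have hTS : T = b - S := by rw [hS]; ring
    rw [hTS]
    field_simp
    rw [hK, hS, hT]
    ring
  exact le_of_mul_le_mul_right (by rw [zero_mul, hid]; exact hNN) hclear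

/-! ### 6. Monotonicity in the floor and the general-floor margin -/

/-- **Monotonicity of the GREEDY margin in the floor.**  For `0 < y ≤ y'` with `γ(y') < 1` (and `0 ≤ u`, `0 ≤ v ≤ 1`,
`0 ≤ T < b`), `Φ(y') ≤ Φ(y)` where
`Φ(z) = (1−u)v − u(1−v)·γ(z)/(1−γ(z)) − ((1−u)(1−v) − uv(1−z)/z)·T/(b−T)`, `γ(z) = max(ρ, z² + (1−z)ρ)`:
raising the floor only makes GREEDY harder. [this work] -/
theorem phi_mono (u v b T ρ y y' γ γ' : ℝ) (hy : 0 < y) (hyy : y ≤ y') (hγ : γ = max ρ (y ^ 2 + (1 - y) * ρ))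
    (hγ' : γ' = max ρ (y' ^ 2 + (1 - y') * ρ)) (hγ'1 : γ' < 1) (hu : 0 ≤ u) (hv : 0 ≤ v) (hv1 : v ≤ 1)
    (hT0 : 0 ≤ T) (hTb : T < b) :
    (1 - u) * v - u * (1 - v) * (γ' / (1 - γ')) - ((1 - u) * (1 - v) - u * v * ((1 - y') / y')) * (T / (b - T))
      ≤ (1 - u) * v - u * (1 - v) * (γ / (1 - γ)) - ((1 - u) * (1 - v) - u * v * ((1 - y) / y)) * (T / (b - T)) := by
  have hγle : γ ≤ γ' := by rw [hγ, hγ']; exact gate_mono ρ y y' hy hyy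
  have hγ1 : γ < 1 := lt_of_le_of_lt hγle hγ'1
  have hy' : 0 < y' := lt_of_lt_of_le hy hyy
  -- the cost `γ/(1-γ)` is increasing in `γ`
  have hcost : γ / (1 - γ) ≤ γ' / (1 - γ') := by
    rw [div_le_div_iff₀ (by linarith) (by linarith)]
    nlinarith
  -- the giant capacity `(1-y)/y` is decreasing in `y`
  have hcap : (1 - y') / y' ≤ (1 - y) / y := by
    rw [div_le_div_iff₀ hy' hy]
    nlinarith
  have hC : 0 ≤ T / (b - T) := div_nonneg hT0 (by linarith)
  have huv1 : 0 ≤ u * (1 - v) := mul_nonneg hu (by linarith)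
  have huv2 : 0 ≤ u * v := mul_nonneg hu hv
  have h1 : u * (1 - v) * (γ / (1 - γ)) ≤ u * (1 - v) * (γ' / (1 - γ')) := mul_le_mul_of_nonneg_left hcost huv1
  have h2 : ((1 - u) * (1 - v) - u * v * ((1 - y) / y)) * (T / (b - T))
      ≤ ((1 - u) * (1 - v) - u * v * ((1 - y') / y')) * (T / (b - T)) := by
    apply mul_le_mul_of_nonneg_right _ hC
    have := mul_le_mul_of_nonneg_left hcap huv2
    linarith
  linarith

/-- **Class aB, sub-case 2, EVERY floor.**  Blobs `(a, u)`, `(b, v)` with `0 < a < b`, gates `u, v < 1/2`, floor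
`0 < y ≤ min(u, v)`, mean `T = au + bv` with `2a ≤ T` (atom `a` low), `ρ = (T−2a)/(b−a)`, `γ = max(ρ, y² + (1−y)ρ)`.  Then the
GREEDY margin `Φ(y) = (1−u)v − u(1−v)·γ/(1−γ) − ((1−u)(1−v) − uv(1−y)/y)·T/(b−T)` is nonnegative: raise the floor to
`min(u,v)` (`phi_mono`) and use `phi_nonneg_small` / `phi_nonneg_big`. [this work] -/
theorem phi_nonneg (u v a b T ρ y γ : ℝ) (hy : 0 < y) (hyu : y ≤ u) (hyv : y ≤ v) (hu : u < 1 / 2) (hv : v < 1 / 2)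
    (ha : 0 < a) (hab : a < b) (hT : T = a * u + b * v) (hlow : 2 * a ≤ T) (hρ : ρ = (T - 2 * a) / (b - a))
    (hγ : γ = max ρ (y ^ 2 + (1 - y) * ρ)) :
    0 ≤ (1 - u) * v - u * (1 - v) * (γ / (1 - γ)) - ((1 - u) * (1 - v) - u * v * ((1 - y) / y)) * (T / (b - T)) := by
  have hupos : 0 < u := lt_of_lt_of_le hy hyu
  have hvpos : 0 < v := lt_of_lt_of_le hy hyv
  have hu0 : u ≠ 0 := ne_of_gt hupos
  have hv0 : v ≠ 0 := ne_of_gt hvpos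
  have hba : 0 < b - a := by linarith
  have hb : 0 < b := ha.trans hab
  have hT0 : 0 ≤ T := by rw [hT]; positivity
  have hTb : T < b := by
    rw [hT]; nlinarith [mul_pos ha (by linarith : (0 : ℝ) < 1 / 2 - u), mul_pos (ha.trans hab) (by linarith : (0 : ℝ) < 1 / 2 - v)]
  -- `ρ ≤ v < 1/2`, hence every gate in sight is `< 1`
  have hρv : ρ ≤ v := by
    rw [hρ, div_le_iff₀ hba, hT]; nlinarith [mul_nonneg ha.le (by linarith : (0 : ℝ) ≤ 2 - u - v)]
  have hgate1 : ∀ z : ℝ, 0 ≤ z → z ≤ 1 / 2 → max ρ (z ^ 2 + (1 - z) * ρ) < 1 := by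
    intro z hz0 hz
    apply max_lt (by linarith)
    nlinarith [mul_nonneg (by linarith : (0 : ℝ) ≤ 1 - z) (by linarith : (0 : ℝ) ≤ v - ρ), mul_nonneg hz0 (by linarith : (0 : ℝ) ≤ 1 / 2 - z)]
  rcases le_total u v with huv | hvu
  · -- floor raised to `u`
    have h1 := phi_nonneg_small u v a b T ρ (max ρ (u ^ 2 + (1 - u) * ρ)) hupos huv hv ha hab hT hlow hρ rfl
    have h2 := phi_mono u v b T ρ y u γ (max ρ (u ^ 2 + (1 - u) * ρ)) hy hyu hγ rfl (hgate1 u hupos.le hu.le) hupos.le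
      hvpos.le (by linarith) hT0 hTb
    have h3 : (1 - u) * (1 - v) - u * v * ((1 - u) / u) = (1 - u) * (1 - 2 * v) := by
      field_simp; ring
    rw [h3] at h2
    linarith
  · -- floor raised to `v`
    have h1 := phi_nonneg_big u v a b T ρ (max ρ (v ^ 2 + (1 - v) * ρ)) hvpos hvu hu ha hab hT hlow hρ rfl
    have h2 := phi_mono u v b T ρ y v γ (max ρ (v ^ 2 + (1 - v) * ρ)) hy hyv hγ rfl (hgate1 v hvpos.le hv.le) hupos.le
      hvpos.le (by linarith) hT0 hTb
    have h3 : (1 - u) * (1 - v) - u * v * ((1 - v) / v) = (1 - v) * (1 - 2 * u) := by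
      field_simp; ring
    rw [h3] at h2
    linarith

/-! ### 7. The three classes -/

/-- **Class G** (`b` giant): the giant atoms carry mass `≥ v`, the low atoms `≤ 1 − v`, and `y(1−v) ≤ (1−y)v` because `y ≤ v`.
[this work] -/
theorem classG (y v : ℝ) (hyv : y ≤ v) : y * (1 - v) ≤ (1 - y) * v := by nlinarith

/-- **Class AB** (both `a` and `b` mids, only atom `0` low; pairs `(0,a)`, `(0,b)` at the heavy gates `T/a`, `T/b`, available iff
`T < a`, resp. `T < b`, capacities `u(1−v)(a−T)/T`, `(1−u)v(b−T)/T` in low-mass units): the residual low mass after the giant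
fits, `(1−u)(1−v) − uv(1−y)/y ≤ ([u(1−v)(a−T)]⁺ + [(1−u)v(b−T)]⁺)/T`.  Without the clipping this is the identity
`⟺ y(a+b) ≤ T`, which holds because `y ≤ u, v`; tight exactly on tied blobs `u = v = y` (DEC-TAMP-G50 §3.8 (AB)). [this work] -/
theorem classAB (u v a b T y : ℝ) (hy : 0 < y) (hyu : y ≤ u) (hyv : y ≤ v) (ha : 0 ≤ a) (hb : 0 ≤ b)
    (hT : T = a * u + b * v) (hTpos : 0 < T) :
    (1 - u) * (1 - v) - u * v * ((1 - y) / y)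
      ≤ (max (u * (1 - v) * (a - T)) 0 + max ((1 - u) * v * (b - T)) 0) / T := by
  have hupos : 0 < u := lt_of_lt_of_le hy hyu
  have hvpos : 0 < v := lt_of_lt_of_le hy hyv
  have hy0 : y ≠ 0 := ne_of_gt hy
  -- unclipped version
  have hyT : y * (a + b) ≤ T := by
    rw [hT]; nlinarith [mul_le_mul_of_nonneg_left hyu ha, mul_le_mul_of_nonneg_left hyv hb]
  have hun : (1 - u) * (1 - v) - u * v * ((1 - y) / y) ≤ (u * (1 - v) * (a - T) + (1 - u) * v * (b - T)) / T := by
    rw [le_div_iff₀ hTpos]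
    have e1 : ((1 - u) * (1 - v) - u * v * ((1 - y) / y)) * T
        = (1 - u - v + 2 * u * v) * T - u * v * (T / y) := by
      field_simp; ring
    have e2 : u * (1 - v) * (a - T) + (1 - u) * v * (b - T) = T - u * v * (a + b) - (u + v - 2 * u * v) * T := by
      rw [hT]; ring
    rw [e1, e2]
    have h3 : u * v * (a + b) ≤ u * v * (T / y) := by
      apply mul_le_mul_of_nonneg_left _ (mul_nonneg hupos.le hvpos.le)
      rw [le_div_iff₀ hy]; linarith
    linarith
  calc (1 - u) * (1 - v) - u * v * ((1 - y) / y) ≤ (u * (1 - v) * (a - T) + (1 - u) * v * (b - T)) / T := hun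
    _ ≤ (max (u * (1 - v) * (a - T)) 0 + max ((1 - u) * v * (b - T)) 0) / T := by
        apply div_le_div_of_nonneg_right _ hTpos.le
        exact add_le_add (le_max_left _ _) (le_max_left _ _)

/-- Class aB, **sub-case 1** (atom `0` fits under the giant, `r ≤ u(1−v)`): the residual `r = (1−v) − uv(1−y)/y` goes through
the pair `(a,b)` at gate `γ ≤ v`, and `r·γ/(1−γ) ≤ (1−u)v` because `γ(y − uv) ≤ y(1−u)v` (DEC-TAMP-G50 §3.8 (aB), two lines:
`γ ≤ v` and `y ≤ v`). [this work] -/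
theorem subcase_one (u v y γ : ℝ) (hy : 0 < y) (hyv : y ≤ v) (hu : 0 ≤ u) (hu1 : u ≤ 1) (hv1 : v < 1) (hγ0 : 0 ≤ γ)
    (hγv : γ ≤ v) :
    ((1 - v) - u * v * ((1 - y) / y)) * (γ / (1 - γ)) ≤ (1 - u) * v := by
  have hγ1 : γ < 1 := lt_of_le_of_lt hγv hv1
  have hy0 : y ≠ 0 := ne_of_gt hy
  have h1γ : (1 - γ) ≠ 0 := by linarith
  have huv0 : 0 ≤ u * v := mul_nonneg hu (by linarith)
  -- key: `γ (y − uv) ≤ y (1−u) v`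
  have key : γ * (y - u * v) ≤ y * (1 - u) * v := by
    rcases le_total y (u * v) with hc | hc
    · have h1 : γ * (y - u * v) ≤ 0 := mul_nonpos_of_nonneg_of_nonpos hγ0 (by linarith)
      have h2 : 0 ≤ y * (1 - u) * v := mul_nonneg (mul_nonneg hy.le (by linarith)) (by linarith)
      linarith
    · have h1 : γ * (y - u * v) ≤ v * (y - u * v) := mul_le_mul_of_nonneg_right hγv (by linarith)
      have h2 : u * v * y ≤ u * v * v := mul_le_mul_of_nonneg_left hyv huv0
      linarith
  have e : ((1 - v) - u * v * ((1 - y) / y)) * (γ / (1 - γ)) = γ * (y * (1 - v) - u * v * (1 - y)) / (y * (1 - γ)) := by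
    set D := 1 - γ with hD
    rw [eq_div_iff (mul_ne_zero hy0 h1γ)]
    field_simp
  rw [e, div_le_iff₀ (mul_pos hy (by linarith))]
  nlinarith [key]

/-- **Class aB** (atom `a` low, `b` mid, `a + b` the only giant), EVERY floor: the minimal mid mass that GREEDY-DEC needs —
the residual `r = (1−v) − uv(1−y)/y` of low mass routed through the pair `(a,b)` (cost `γ/(1−γ)`, at most the `u(1−v)` units of
atom `a`) and then through `(0,b)` (cost `T/(b−T)`) — never exceeds the mid mass `(1−u)v`.  Hypotheses: `0 < a < b`, gates
`y ≤ u ≤ 1`, `y ≤ v < 1`, floor `y > 0`, `2a ≤ T = au + bv`, `γ = max(ρ, y² + (1−y)ρ)`, `ρ = (T−2a)/(b−a)`.  (For `v = 1`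
there is no low mass at all.)  Together with `classG` and `classAB` this is BLOB-DEC(2): the DEC(j') programme of ARCH is
feasible for every two-heavy-blob structure at every floor and every non-dominant layer (BLOB-DEC2-G51 §1–2). [this work] -/
theorem classaB (u v a b T ρ y γ : ℝ) (hy : 0 < y) (hyu : y ≤ u) (hyv : y ≤ v) (hu1 : u ≤ 1) (hv1 : v < 1)
    (ha : 0 < a) (hab : a < b) (hT : T = a * u + b * v) (hlow : 2 * a ≤ T) (hρ : ρ = (T - 2 * a) / (b - a))
    (hγ : γ = max ρ (y ^ 2 + (1 - y) * ρ)) :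
    (γ / (1 - γ)) * min ((1 - v) - u * v * ((1 - y) / y)) (u * (1 - v))
        + (T / (b - T)) * max ((1 - v) - u * v * ((1 - y) / y) - u * (1 - v)) 0
      ≤ (1 - u) * v := by
  have hupos : 0 < u := lt_of_lt_of_le hy hyu
  have hvpos : 0 < v := lt_of_lt_of_le hy hyv
  have hba : 0 < b - a := by linarith
  have hρv : ρ ≤ v := by rw [hρ]; exact rho_le u v a b T hu1 hv1.le ha.le hab hT
  have hρ0 : 0 ≤ ρ := by rw [hρ]; exact div_nonneg (by linarith) hba.le
  have hγ0 : 0 ≤ γ := by rw [hγ]; exact le_trans hρ0 (le_max_left _ _)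
  have hγv : γ ≤ v := by
    rw [hγ]; apply max_le hρv
    nlinarith [mul_nonneg (by linarith : (0 : ℝ) ≤ 1 - y) (by linarith : (0 : ℝ) ≤ v - ρ), mul_nonneg hy.le (by linarith : (0 : ℝ) ≤ v - y)]
  by_cases h1 : (1 - v) - u * v * ((1 - y) / y) ≤ u * (1 - v)
  · -- sub-case 1: everything through the pair `(a, b)`
    rw [min_eq_left h1, max_eq_right (by linarith), mul_zero, add_zero]
    have := subcase_one u v y γ hy hyv hupos.le hu1 hv1 hγ0 hγv
    linarith
  · -- sub-case 2: forces `u, v < 1/2`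
    have h2 := lt_of_not_ge h1
    rw [min_eq_right h2.le, max_eq_left (by linarith)]
    have hyq : (1 - y) * (u * v) < y * ((1 - u) * (1 - v)) := by
      have h2' : u * v * ((1 - y) / y) < (1 - u) * (1 - v) := by linarith
      have e : u * v * ((1 - y) / y) = ((1 - y) * (u * v)) / y := by ring
      rw [e, div_lt_iff₀ hy] at h2'
      linarith
    have hu2 : u < 1 / 2 := by
      by_contra hge
      rw [not_lt] at hge
      -- `(1-u) ≤ u` and `(1-v) y ≤ (1-y) v`
      have h4 : (1 - u) * ((1 - v) * y) ≤ u * ((1 - y) * v) :=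
        mul_le_mul (by linarith) (by nlinarith) (mul_nonneg (by linarith) hy.le) hupos.le
      linarith
    have hv2 : v < 1 / 2 := by
      by_contra hge
      rw [not_lt] at hge
      have h4 : (1 - v) * ((1 - u) * y) ≤ v * ((1 - y) * u) :=
        mul_le_mul (by linarith) (by nlinarith) (mul_nonneg (by linarith) hy.le) hvpos.le
      linarith
    have hΦ := phi_nonneg u v a b T ρ y γ hy hyu hyv hu2 hv2 ha hab hT hlow hρ hγ
    have e : (1 - v) - u * v * ((1 - y) / y) - u * (1 - v) = (1 - u) * (1 - v) - u * v * ((1 - y) / y) := by ring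
    rw [e]
    linarith

end BlobDec2

end Quant

end Summit.CriticalPhenomena.PercolationContinuityZ3.Theorems
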